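/-
Copyright (c) 2026 the pub-hodgecm-mathlib formalisation cell (harness21).  Prover seat hodgecm-mathlib-K2E3-p21 (g7), HCML Track B «K2-LIT» ∕ h413
(`stmt-HodgeConjecture-24833`), line `K2_E3_EllipticInputs`, leaf (nsc-S-A′) `sig_K2E3GL3PrincipalBlockStandardSpan`, case socket (S-A′-C0) `sig_K2E3GL3SAprimeC0`
(U12 MAIN ED. 30 :468), H-layer case brick C0-IRR (file 2 of 2) of the architect's `MEMO-SA-architecture.v2.K2E3-p25-g2.md` §3 (architect K2E3-p25 (g2); dealer K2E3-plan (g4) D97).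
-/
import Summits.HodgeConjecture.HodgeConjecture.Theorems.K2E3GL3WeightOrbitConstancy       -- ★ C0-IRR file 1 (this seat, p859910): orbit constancy, parity, fibres of `w ↦ θ ∘ w⁻¹`
import Summits.HodgeConjecture.HodgeConjecture.Theorems.K2E3GL3PrincipalSeriesExhaustion    -- ★ EXH (p23): `eq_top_of_forall_finrank_weightSpace_eq_principalSeries`, `finiteDimensional_jacquet_principalSeries`, `isSmooth_principalSeries` (+ ★ ADD, ★ H0-a, ★ E4a)
import Summits.HodgeConjecture.HodgeConjecture.Theorems.K2E3GL3PrincipalSeriesRegular       -- ★ REG (p23): `eq_of_tch_coe_eq` (`tch` is injective on triples)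
import Summits.HodgeConjecture.HodgeConjecture.Theorems.K2E3GL3ExponentRules                 -- ★ H0 (architect p25): `finrank_weightSpace_le_swap₀₁ ∕ ₁₂`, `even_finrank_weightSpace₀₁`
import Summits.HodgeConjecture.HodgeConjecture.Theorems.K2E3GL3EmbeddingOfWeight             -- ★ EMB (p17): `finrank_weightSpace_ne_zero_of_intertwiningMap_ne_zero`
import Summits.HodgeConjecture.HodgeConjecture.Theorems.K2E3GL3StandardModuleEmbedding        -- ★ STD-EMB (p03): `isOpen_ker_tch`
import Summits.HodgeConjecture.HodgeConjecture.Theorems.K2E3GL2UnlinkedIrreducible            -- ★ GL2-UNL (p11): `isIrreducible_parabolicIndGL_two_of_not_linked` (+ ★ `unramifiedTwist`, `MonoidHom.continuous_of_isOpen_ker`)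
import Literature.RepresentationTheory.FiniteGroups.EquivOfCharacter                        -- ★ `Subrepresentation.subtypeIntertwiningMap`, `…_ne_zero`
import HarnessLib

/-!
# Crux `H413` — leaf (nsc-S-A′), case socket (S-A′-C0): THE PRINCIPAL SERIES `I θ = θ₀ × θ₁ × θ₂` OF `GL₃(F)` IS IRREDUCIBLE WHEN NO TWO LETTERS ARE LINKED AND NOT ALL
# THREE ARE EQUAL (brick C0-IRR, file 2: the main theorem; modulo the weak 3-cell binder `h3cell` of ★ E4a only — the H0 rules are ★ and discharged here)

Cell `hodgecm-mathlib`, Track B; THEOREMS ONLY; count-neutral helper (`--supports stmt-HodgeConjecture-24833 --as helper`).  Currency (CONVENTIONS 08:40Z, MEMO v2 §0),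
written inline (no definition): torus `LB 3 = Π a : Fin 3, GL {i // id i = a} F`, `tch θ = ∏ a, (θ a) ∘ det ∘ ev_a` for `θ : Fin 3 → (Fˣ →* ℂˣ)`,
`I θ = parabolicIndGL F id (𝟙.twist (tch θ))`, `r_B V = (restrictUnipotentGL F id V).Coinvariants`, `mult V η = finrank ℂ ↥(⨅ m, maxGenEigenspace (normalizedJacquetGL F id V m) (η m))`,
`I₂ x y = parabolicIndGL F (lastBlockLabel 2) (𝟙.twist (maxParabolicLeviChar F 2 x y))` (the `GL₂` principal series `x × y`), `ν = (unramifiedTwist F 1).toMonoidHom` (`ν t = ‖t‖`);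
«`x, y` LINKED» means `y = x ν` or `x = y ν`.

THE MATHEMATICS ([BernsteinZelevinsky1977, Thm. 2.9, Cor. 2.13, Thm. 4.2]; [Zelevinsky1980, Thm. 4.2 p. 184]; [Casselman1995, §6.3–6.4]) — the `n = 3` exponent calculus:
the exponents of `I θ` are the six `tch (θ ∘ w⁻¹)` counted with multiplicity `#fibre` (★ H0-a).  Let `0 ≠ N ≤ I θ`:
* `mult N (tch θ) ≠ 0` — `N ↪ I θ = I(tch θ)` and ★ EMB's converse of Frobenius (`r_B N` is finite-dimensional, ★ ADD);
* all ordered pairs `(θ i, θ j)` are unlinked, so every `I₂ (θ i) (θ j)` is irreducible (★ GL2-UNL), the ★ H0 rules `finrank_weightSpace_le_swap₀₁ ∕ ₁₂` act both ways and generate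
  `S₃`: `mult N (tch (θ ∘ w)) = c` is CONSTANT on the orbit (★ file 1 `finrank_weightSpace_tch_comp_perm`), and EVEN at a coincidence `θ i = θ j` (★ H0
  `even_finrank_weightSpace₀₁`, ★ file 1 `even_finrank_weightSpace_tch_of_apply_eq`);
* `tch` is injective on triples (★ REG `eq_of_tch_coe_eq`), so `mult (I θ) (tch (θ ∘ w₀⁻¹)) = #{w : θ ∘ w₀⁻¹ = θ ∘ w⁻¹}`, which is `≤ 1` for pairwise distinct letters and `≤ 2`
  when not all letters are equal (★ file 1 `card_filter_comp_perm_symm_eq_le_one ∕ _le_two`); since `c ≥ 1`, resp. `c ≥ 2` (even and non-zero) at a coincidence,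
  `mult N = mult (I θ)` on the orbit, and both vanish off it (★ ADD `finrank_weightSpace_subrepresentation_le`) ⇒ ★ EXH (b) ⇒ `N = ⊤`.
* §1 **`isIrreducible_principalSeries_three_of_isIrreducible_pairs`** (input: every `I₂ (θ i) (θ j)`, `i ≠ j`, irreducible) and the socket shape
  **`isIrreducible_principalSeries_three_of_unlinked`** (input: `∀ i j, i ≠ j → θ j ≠ θ i * ν`, via ★ GL2-UNL) = the statement bytes of `sig_K2E3GL3SAprimeC0` (U12 :468)
  with the ONE extra binder `h3cell` (★ E4a's weak 3-cell lemma VERBATIM, to be discharged by E4b — the architect's «one unheld input», 11:51:18Z); the tie is then one line.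
  The all-equal support `{x, x, x}` is excluded (`hne`); it is closed inside the ASM skeleton by ★ IH-5.

HONEST LABEL: HC_CM is proved only modulo the 7 printed citations (2 remaining named inputs: hLiu418 = stmt-HodgeConjecture-24832, h413 = stmt-HodgeConjecture-24833) until
rung 0 closes; count-neutral helper, closes no socket by itself; CONDITIONAL on the binder `h3cell` (E4b), stated as a hypothesis, not assumed as a fact.

## Mathlib ∕ tree search
Tree ★: file 1 `K2E3GL3WeightOrbitConstancy` · EXH · REG `eq_of_tch_coe_eq` · H0 `K2E3GL3ExponentRules` · EMB · STD-EMB `isOpen_ker_tch` · GL2-UNL · ADD `finiteDimensional_jacquet_subrepresentation ∕ finrank_weightSpace_subrepresentation_le` ·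
`IsSmooth.toRepresentation` · `Subrepresentation.subtypeIntertwiningMap_ne_zero` · `MonoidHom.continuous_of_isOpen_ker` · `Representation.Coinvariants.mk_surjective`.
Mathlib: `Finset.card_le_card`, `Finset.card_ne_zero_of_mem`, `Finset.filter_eq_empty_iff`, `Even.two_dvd`, `Nat.le_of_dvd`, `Function.not_injective_iff`, `IsSimpleOrder`.
Dedup: `lean search 'isIrreducible_principalSeries_three|of_unlinked'` — none (★ IH-5 `isIrreducible_parabolicIndGL_id_three_self` is the disjoint all-equal case).
Elaboration note: no `rw` ∕ `rcases` across the `I θ`- and `N`-multiplicity terms (their unification ∕ `whnf` is expensive) — equalities are chained with `trans_le` ∕ `le_of_le_of_eq`.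

## References
* [BernsteinZelevinsky1977] I. N. Bernstein, A. V. Zelevinsky, *Induced representations of reductive p-adic groups I*, Ann. Sci. ÉNS 10 (1977), Thm. 2.9, Cor. 2.13, §2.3, Thm. 4.2.
* [Zelevinsky1980] A. V. Zelevinsky, *Induced representations of reductive p-adic groups II*, Ann. Sci. ÉNS 13 (1980), Thm. 4.2 (p. 184), §9.
* [Casselman1995] W. Casselman, *Introduction to the theory of admissible representations of p-adic reductive groups* (draft 1995), §6.3 (Thm. 6.3.5), §6.4.
-/

set_option autoImplicit false
-- the mandated namespace repeats `HodgeConjecture.HodgeConjecture`, as in every `Theorems/*.lean` of this sub-problem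
set_option linter.dupNamespace false

noncomputable section

open Representation Module Function Equiv Literature.NumberTheory.Automorphic Literature.NumberTheory.Automorphic.Zelevinsky1980
open Literature.NumberTheory.GaloisRepresentations.IsNonarchimedeanLocalField Literature.RepresentationTheory.FiniteGroups
open scoped MatrixGroups
open Summit.HodgeConjecture.HodgeConjecture.Cruxes.H413.K2E3GL3JacquetMultiplicityAdditive
open Summit.HodgeConjecture.HodgeConjecture.Cruxes.H413.K2E3GL3PrincipalSeriesExponents (finrank_weightSpace_principalSeries_three_tch)
open Summit.HodgeConjecture.HodgeConjecture.Cruxes.H413.K2E3GL3PrincipalSeriesExhaustion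
open Summit.HodgeConjecture.HodgeConjecture.Cruxes.H413.K2E3GL3PrincipalSeriesRegular (eq_of_tch_coe_eq)
open Summit.HodgeConjecture.HodgeConjecture.Cruxes.H413.K2E3GL3ExponentRules (finrank_weightSpace_le_swap₀₁ finrank_weightSpace_le_swap₁₂ even_finrank_weightSpace₀₁)
open Summit.HodgeConjecture.HodgeConjecture.Cruxes.H413.K2E3GL3EmbeddingOfWeight (finrank_weightSpace_ne_zero_of_intertwiningMap_ne_zero)
open Summit.HodgeConjecture.HodgeConjecture.Cruxes.H413.K2E3GL3StandardModuleEmbedding (isOpen_ker_tch)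
open Summit.HodgeConjecture.HodgeConjecture.Cruxes.H413.K2E3GL2UnlinkedIrreducible (isIrreducible_parabolicIndGL_two_of_not_linked)
open Summit.HodgeConjecture.HodgeConjecture.Cruxes.H413.K2E3GL3WeightOrbitConstancy

namespace Summit.HodgeConjecture.HodgeConjecture.Cruxes.H413.K2E3GL3PrincipalSeriesIrreducibleUnlinked

variable {F : Type} [Field F] [ValuativeRel F] [TopologicalSpace F] [IsNonarchimedeanLocalField F]

set_option maxHeartbeats 800000 in  -- the long `I θ`-statements (elaboration ∕ `whnf` of large Jacquet terms, no search)
/-- **C0-IRR, PAIR FORM — `I θ` IS IRREDUCIBLE WHEN EVERY `I₂ (θ i) (θ j)` (`i ≠ j`) IS IRREDUCIBLE AND NOT ALL THREE LETTERS ARE EQUAL.**  For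
`θ : Fin 3 → (F^× →* ℂ^×)` with open kernels: modulo the weak 3-cell binder `h3cell` of ★ E4a (VERBATIM), the principal series `I θ` is irreducible.
Proof: a subrepresentation `N ≠ ⊥` has the weight `tch θ` (★ EMB converse on `N ↪ I θ`), hence — by ★ orbit constancy under the ★ H0 rules — every weight
`tch (θ ∘ w⁻¹)` with one common multiplicity `c ≥ 1`, even at a coincidence; ★ H0-a's exponent count is `#fibre ≤ 2` (`≤ 1` for distinct letters, ★ REG injectivity),
so `mult N = mult (I θ)` and ★ EXH (b) gives `N = ⊤`. [cite: BernsteinZelevinsky1977, Thm. 2.9, Cor. 2.13, Thm. 4.2] [cite: Zelevinsky1980, Thm. 4.2] [cite: Casselman1995, Thm. 6.3.5, §6.4] -/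
theorem isIrreducible_principalSeries_three_of_isIrreducible_pairs (θ : Fin 3 → (Fˣ →* ℂˣ)) (hθ : ∀ a, IsOpen (((θ a).ker : Subgroup Fˣ) : Set Fˣ))
    (h3cell : ∀ c : Fin 3 → Fin 2, Monotone c → Function.Surjective c →
      ∀ (W : Type) [AddCommGroup W] [Module ℂ W] (σ : Representation ℂ (Π a : Fin 2, GL {i : Fin 3 // c i = a} F) W),
        σ.IsIrreducible → σ.IsSmooth → σ.IsSupercuspidal →
        ∀ (N : Subrepresentation (jacquetGL F c (parabolicIndGL F (id : Fin 3 → Fin 3)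
            ((Representation.trivial ℂ (Π a : Fin 3, GL {i : Fin 3 // (id : Fin 3 → Fin 3) i = a} F) ℂ).twist
              (∏ a : Fin 3, (θ a).comp (Matrix.GeneralLinearGroup.det.comp
                (Pi.evalMonoidHom (fun a : Fin 3 => GL {i : Fin 3 // (id : Fin 3 → Fin 3) i = a} F) a)))))))
          (q : N.toRepresentation.IntertwiningMap σ), q = 0)
    (hirr : ∀ i j : Fin 3, i ≠ j → (Representation.parabolicIndGL F (lastBlockLabel 2) ((Representation.trivial ℂ (Π a : Bool, GL {i : Fin 2 // lastBlockLabel 2 i = a} F) ℂ).twist (maxParabolicLeviChar F 2 (θ i) (θ j)))).IsIrreducible)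
    (hne : ¬ (θ 0 = θ 1 ∧ θ 1 = θ 2)) :
    (parabolicIndGL F (id : Fin 3 → Fin 3) ((Representation.trivial ℂ (Π a : Fin 3, GL {i : Fin 3 // (id : Fin 3 → Fin 3) i = a} F) ℂ).twist (∏ a : Fin 3, (θ a).comp (Matrix.GeneralLinearGroup.det.comp (Pi.evalMonoidHom (fun a : Fin 3 => GL {i : Fin 3 // (id : Fin 3 → Fin 3) i = a} F) a))))).IsIrreducible := by
  classical
  have hθ' := isOpen_ker_tch θ hθ
  haveI := finiteDimensional_jacquet_principalSeries θ hθ'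
  have hIs := isSmooth_principalSeries θ
  -- ★ H0-a: the exponents of `I θ`, counted by the fibres of `w ↦ θ ∘ w⁻¹`
  have hmult : ∀ η : (Π a : Fin 3, GL {i : Fin 3 // (id : Fin 3 → Fin 3) i = a} F) → ℂ,
      finrank ℂ ↥(⨅ m, Module.End.maxGenEigenspace (normalizedJacquetGL F (id : Fin 3 → Fin 3) (parabolicIndGL F (id : Fin 3 → Fin 3) ((Representation.trivial ℂ (Π a : Fin 3, GL {i : Fin 3 // (id : Fin 3 → Fin 3) i = a} F) ℂ).twist (∏ a : Fin 3, (θ a).comp (Matrix.GeneralLinearGroup.det.comp (Pi.evalMonoidHom (fun a : Fin 3 => GL {i : Fin 3 // (id : Fin 3 → Fin 3) i = a} F) a))))) m) (η m)) =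
      ((Finset.univ : Finset (Equiv.Perm (Fin 3))).filter fun w => η = fun m =>
        (((∏ a : Fin 3, ((fun a => θ (w.symm a)) a).comp (Matrix.GeneralLinearGroup.det.comp (Pi.evalMonoidHom (fun a : Fin 3 => GL {i : Fin 3 // (id : Fin 3 → Fin 3) i = a} F) a))) m : ℂˣ) : ℂ)).card :=
    fun η => (finrank_weightSpace_principalSeries_three_tch θ hθ' η).2
  -- `I θ ≠ 0`: the weight `tch θ` occurs (`w = 1` lies in its fibre)
  have hI0 : finrank ℂ ↥(⨅ m, Module.End.maxGenEigenspace (normalizedJacquetGL F (id : Fin 3 → Fin 3) (parabolicIndGL F (id : Fin 3 → Fin 3) ((Representation.trivial ℂ (Π a : Fin 3, GL {i : Fin 3 // (id : Fin 3 → Fin 3) i = a} F) ℂ).twist (∏ a : Fin 3, (θ a).comp (Matrix.GeneralLinearGroup.det.comp (Pi.evalMonoidHom (fun a : Fin 3 => GL {i : Fin 3 // (id : Fin 3 → Fin 3) i = a} F) a))))) m) (((∏ a : Fin 3, (θ a).comp (Matrix.GeneralLinearGroup.det.comp (Pi.evalMonoidHom (fun a : Fin 3 => GL {i : Fin 3 //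 (id : Fin 3 → Fin 3) i = a} F) a))) m : ℂˣ) : ℂ)) ≠ 0 := by
    rw [hmult]
    exact Finset.card_ne_zero_of_mem (Finset.mem_filter.2 ⟨Finset.mem_univ 1, rfl⟩)
  haveI : Nontrivial (Subrepresentation (parabolicIndGL F (id : Fin 3 → Fin 3) ((Representation.trivial ℂ (Π a : Fin 3, GL {i : Fin 3 // (id : Fin 3 → Fin 3) i = a} F) ℂ).twist (∏ a : Fin 3, (θ a).comp (Matrix.GeneralLinearGroup.det.comp (Pi.evalMonoidHom (fun a : Fin 3 => GL {i : Fin 3 // (id : Fin 3 → Fin 3) i = a} F) a)))))) := by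
    obtain ⟨x, -, hx0⟩ := (Submodule.ne_bot_iff _).1 fun hb => hI0 (Submodule.finrank_eq_zero.2 hb)
    obtain ⟨v, rfl⟩ := Representation.Coinvariants.mk_surjective _ x
    have hv0 : v ≠ 0 := by rintro rfl; exact hx0 (map_zero _)
    refine ⟨⟨⊥, ⊤, fun h => hv0 ?_⟩⟩
    have hvb : v ∈ (⊥ : Subrepresentation (parabolicIndGL F (id : Fin 3 → Fin 3) ((Representation.trivial ℂ (Π a : Fin 3, GL {i : Fin 3 // (id : Fin 3 → Fin 3) i = a} F) ℂ).twist (∏ a : Fin 3, (θ a).comp (Matrix.GeneralLinearGroup.det.comp (Pi.evalMonoidHom (fun a : Fin 3 => GL {i : Fin 3 // (id : Fin 3 → Fin 3) i = a} F) a)))))) := by rw [h]; trivial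
    exact (Submodule.mem_bot ℂ).1 hvb
  refine { eq_bot_or_eq_top := fun N => ?_ }
  by_contra hN
  push Not at hN
  obtain ⟨hNb, hNt⟩ := hN
  have hNs : N.toRepresentation.IsSmooth := hIs.toRepresentation N
  haveI : FiniteDimensional ℂ (restrictUnipotentGL F (id : Fin 3 → Fin 3) N.toRepresentation).Coinvariants :=
    finiteDimensional_jacquet_subrepresentation _ monotone_id hIs N
  -- (1) the weight `tch θ` OCCURS in `N` (★ EMB converse of Frobenius on `N ↪ I θ`)
  have h1 := finrank_weightSpace_ne_zero_of_intertwiningMap_ne_zero N.toRepresentation hNs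
    (∏ a : Fin 3, (θ a).comp (Matrix.GeneralLinearGroup.det.comp (Pi.evalMonoidHom (fun a : Fin 3 => GL {i : Fin 3 // (id : Fin 3 → Fin 3) i = a} F) a)))
    (Subrepresentation.subtypeIntertwiningMap N) (Subrepresentation.subtypeIntertwiningMap_ne_zero hNb)
  -- (2) orbit constancy and parity on `N` (★ file 1, the ★ H0 rules plugged in)
  have h2 := fun w => finrank_weightSpace_tch_comp_perm
    (fun V hV _ x y z hx hy _ h₁ => finrank_weightSpace_le_swap₀₁ V hV x y z hx hy h₁)
    (fun V hV _ x y z _ hy hz h₁ => finrank_weightSpace_le_swap₁₂ V hV x y z hy hz h₁) N.toRepresentation hNs θ hθ hirr w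
  have hev : ∀ i j : Fin 3, i ≠ j → θ i = θ j → Even (finrank ℂ ↥(⨅ m, Module.End.maxGenEigenspace (normalizedJacquetGL F (id : Fin 3 → Fin 3) N.toRepresentation m) (((∏ a : Fin 3, (θ a).comp (Matrix.GeneralLinearGroup.det.comp (Pi.evalMonoidHom (fun a : Fin 3 => GL {i : Fin 3 // (id : Fin 3 → Fin 3) i = a} F) a))) m : ℂˣ) : ℂ))) :=
    fun i j hij he => even_finrank_weightSpace_tch_of_apply_eq
      (fun V hV _ x y z hx hy _ h₁ => finrank_weightSpace_le_swap₀₁ V hV x y z hx hy h₁)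
      (fun V hV _ x y z _ hy hz h₁ => finrank_weightSpace_le_swap₁₂ V hV x y z hy hz h₁)
      (fun V hV _ x z hx _ h => even_finrank_weightSpace₀₁ V hV x z hx h) N.toRepresentation hNs θ hθ hirr hij he
  -- (3) the key count on the orbit: `#{w : tch (θ ∘ w₀⁻¹) = tch (θ ∘ w⁻¹)} ≤ mult N (tch (θ ∘ w₀⁻¹)) (= mult N (tch θ))`
  have hkey : ∀ w₀ : Equiv.Perm (Fin 3),
      ((Finset.univ : Finset (Equiv.Perm (Fin 3))).filter fun w => (fun m : (Π a : Fin 3, GL {i : Fin 3 // (id : Fin 3 → Fin 3) i = a} F) =>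
          (((∏ a : Fin 3, ((fun a => θ (w₀.symm a)) a).comp (Matrix.GeneralLinearGroup.det.comp (Pi.evalMonoidHom (fun a : Fin 3 => GL {i : Fin 3 // (id : Fin 3 → Fin 3) i = a} F) a))) m : ℂˣ) : ℂ)) =
        fun m => (((∏ a : Fin 3, ((fun a => θ (w.symm a)) a).comp (Matrix.GeneralLinearGroup.det.comp (Pi.evalMonoidHom (fun a : Fin 3 => GL {i : Fin 3 // (id : Fin 3 → Fin 3) i = a} F) a))) m : ℂˣ) : ℂ)).card ≤
      finrank ℂ ↥(⨅ m, Module.End.maxGenEigenspace (normalizedJacquetGL F (id : Fin 3 → Fin 3) N.toRepresentation m) (((∏ a : Fin 3, ((fun a => θ (w₀.symm a)) a).comp (Matrix.GeneralLinearGroup.det.comp (Pi.evalMonoidHom (fun a : Fin 3 => GL {i : Fin 3 // (id : Fin 3 → Fin 3) i = a} F) a))) m : ℂˣ) : ℂ)) := by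
    intro w₀
    refine le_of_le_of_eq ((Finset.card_le_card (t := (Finset.univ : Finset (Equiv.Perm (Fin 3))).filter
      fun w : Equiv.Perm (Fin 3) => (fun a => θ (w₀.symm a)) = fun a => θ (w.symm a)) fun w hw => ?_).trans ?_) (h2 w₀.symm).symm
    · rw [Finset.mem_filter] at hw ⊢
      exact ⟨hw.1, eq_of_tch_coe_eq _ _ hw.2⟩
    by_cases hinj : Function.Injective θ
    · -- distinct letters: the fibre is a singleton and `mult N (tch θ) ≥ 1`
      exact (card_filter_comp_perm_symm_eq_le_one θ hinj w₀).trans (Nat.one_le_iff_ne_zero.2 h1)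
    · -- a coincidence `θ i = θ j`: the fibre has `≤ 2` elements and `mult N (tch θ)` is even and non-zero
      have hx : ∃ i j : Fin 3, θ i = θ j ∧ i ≠ j := Function.not_injective_iff.1 hinj
      obtain ⟨i, j, he, hij⟩ := hx
      exact (card_filter_comp_perm_symm_eq_le_two θ hne w₀).trans (Nat.le_of_dvd (Nat.pos_of_ne_zero h1) (hev i j hij he).two_dvd)
  -- (4) `mult N = mult (I θ)` for every `η`, hence `N = ⊤` by ★ EXH (b)
  refine hNt (eq_top_of_forall_finrank_weightSpace_eq_principalSeries θ hθ' h3cell N fun η => ?_)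
  refine le_antisymm (finrank_weightSpace_subrepresentation_le _ hIs N η) ((hmult η).trans_le ?_)
  by_cases hη : ∃ w₀ : Equiv.Perm (Fin 3), η = fun m =>
      (((∏ a : Fin 3, ((fun a => θ (w₀.symm a)) a).comp (Matrix.GeneralLinearGroup.det.comp (Pi.evalMonoidHom (fun a : Fin 3 => GL {i : Fin 3 // (id : Fin 3 → Fin 3) i = a} F) a))) m : ℂˣ) : ℂ)
  · -- on the orbit
    obtain ⟨w₀, rfl⟩ := hη
    exact hkey w₀
  · -- off the orbit the fibre is empty
    exact (Finset.card_eq_zero.2 <| Finset.filter_eq_empty_iff.2 fun w _ hw => hη ⟨w, hw⟩).trans_le (Nat.zero_le _)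

set_option maxHeartbeats 400000 in  -- statement elaboration, as above
/-- **C0-IRR — THE PRINCIPAL SERIES `θ₀ × θ₁ × θ₂` OF `GL₃(F)` WITH NO TWO LETTERS LINKED AND NOT ALL THREE EQUAL IS IRREDUCIBLE** — the statement bytes of the case socket
`sig_K2E3GL3SAprimeC0` (U12 MAIN ED. 30 :468) with the one extra binder `h3cell` (★ E4a's weak 3-cell lemma, VERBATIM; discharged by E4b at the tie): for `θ` with
open kernels, `∀ i j, i ≠ j → θ j ≠ θ i · ν` and `¬ (θ 0 = θ 1 ∧ θ 1 = θ 2)` ⇒ `I θ` irreducible.  The unlinked pairs give irreducible `I₂ (θ i) (θ j)` by ★ GL2-UNL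
(`isIrreducible_parabolicIndGL_two_of_not_linked`; continuity from the open kernels), then the pair form applies. [cite: Zelevinsky1980, Thm. 4.2 p. 184]
[cite: BernsteinZelevinsky1977, Thm. 2.9, Thm. 4.2] [cite: Casselman1995, §6.4] -/
theorem isIrreducible_principalSeries_three_of_unlinked (θ : Fin 3 → (Fˣ →* ℂˣ)) (hθ : ∀ a, IsOpen (((θ a).ker : Subgroup Fˣ) : Set Fˣ))
    (h3cell : ∀ c : Fin 3 → Fin 2, Monotone c → Function.Surjective c →
      ∀ (W : Type) [AddCommGroup W] [Module ℂ W] (σ : Representation ℂ (Π a : Fin 2, GL {i : Fin 3 // c i = a} F) W),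
        σ.IsIrreducible → σ.IsSmooth → σ.IsSupercuspidal →
        ∀ (N : Subrepresentation (jacquetGL F c (parabolicIndGL F (id : Fin 3 → Fin 3)
            ((Representation.trivial ℂ (Π a : Fin 3, GL {i : Fin 3 // (id : Fin 3 → Fin 3) i = a} F) ℂ).twist
              (∏ a : Fin 3, (θ a).comp (Matrix.GeneralLinearGroup.det.comp
                (Pi.evalMonoidHom (fun a : Fin 3 => GL {i : Fin 3 // (id : Fin 3 → Fin 3) i = a} F) a)))))))
          (q : N.toRepresentation.IntertwiningMap σ), q = 0)
    (hunl : ∀ i j : Fin 3, i ≠ j → θ j ≠ θ i * ((unramifiedTwist F 1 : QuasiChar F).toMonoidHom)) (hne : ¬ (θ 0 = θ 1 ∧ θ 1 = θ 2)) :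
    (parabolicIndGL F (id : Fin 3 → Fin 3) ((Representation.trivial ℂ (Π a : Fin 3, GL {i : Fin 3 // (id : Fin 3 → Fin 3) i = a} F) ℂ).twist (∏ a : Fin 3, (θ a).comp (Matrix.GeneralLinearGroup.det.comp (Pi.evalMonoidHom (fun a : Fin 3 => GL {i : Fin 3 // (id : Fin 3 → Fin 3) i = a} F) a))))).IsIrreducible := by
  haveI : IsTopologicalRing F := inferInstance
  have hcont : ∀ a, Continuous fun t => (((θ a) t : ℂˣ) : ℂ) := fun a =>
    Units.continuous_val.comp (MonoidHom.continuous_of_isOpen_ker (θ a) (hθ a))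
  exact isIrreducible_principalSeries_three_of_isIrreducible_pairs θ hθ h3cell
    (fun i j hij => isIrreducible_parabolicIndGL_two_of_not_linked (θ i) (θ j) (hcont i) (hcont j) (hunl i j hij) (hunl j i hij.symm)) hne

end Summit.HodgeConjecture.HodgeConjecture.Cruxes.H413.K2E3GL3PrincipalSeriesIrreducibleUnlinked

end
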